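import Literature.NumberTheory.EllipticCurves.IwasawaLocalKummerQuotientProofs
import Literature.NumberTheory.EllipticCurves.OrdinaryLocalKummerCountProofs
import Literature.NumberTheory.EllipticCurves.OrdinaryReductionKernelTorsionProofs
import Literature.NumberTheory.EllipticCurves.FormalGroupKummerPointProofs
import Literature.NumberTheory.EllipticCurves.GaloisConjugateReductionLayerProofs
import HarnessLib

/-!
# The reduction map of a globally minimal `E/ℚ` on `E(K̄_v)` at a good ordinary `v ∋ p`

`Proofs` file (theorems only: **no definition and no named fact is introduced**) in topic
`NumberTheory/EllipticCurves`; the local inputs of the elementary proof of Greenberg's Lemma 3.4 at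
the layer `n = 0` (R. Greenberg, *Iwasawa theory for elliptic curves*, LNM 1716 (1999), §3 Lemma
3.4, p. 89 of the held copy `book:coates1999-arithmetic-theory-elliptic-curves`), assembled in
`SelmerCorankControlRatOrdinaryProofs`. For a globally minimal `W/ℚ`, the place `v ∋ p`, the
spectral valuation `w` of `K̄_v` and the reduction map
`red₀ : E(K̄_v) → (W_ℤ mod 𝔪_w)(k̄_v)` of the integral model `W_ℤ ⊗ 𝒪_w`
(`goodReductionHom`, transported along `W_ℤ ⊗ K̄_v = W ⊗ K̄_v`; here an abstract additive map
`red₀` pinned down by its values, hypothesis `hred₀`):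

* §1 `p` is a uniformiser of `ℤ_v` (`irreducible_natCast_adicCompletionIntegers_rat`), and an
  element of `Γ_{K_v}` fixing `μ_{p^∞}(K̄_v)` restricts into `ker κ` for the cyclotomic `κ`
  (`resGal_mem_kerSubgroup_of_forall_smul_rootOfUnity_eq`);
* §2 `ker red₀` is `Γ_{ℚ_v}`-stable and equals the formal-group kernel `E₁`
  (`localRed_smul_eq_zero_iff`, `localRed_eq_zero_iff_mem_kernel`); the ordinary point and the
  ordinary filtration transported to `E(K̄_v)` (`exists_zsmul_eq_zero_localRed_ne_zero`,
  `localRed_ordinary_filtration`: generators of `ker red₀ ∩ E[p^r]`, `red₀(E[p^r]) = Ẽ[p^r]`,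
  `p`-divisibility of `ker red₀`); `E(K̄_v)/E₁` is torsion (`exists_nsmul_localRed_eq_zero`); the
  reductions fixed by a Frobenius form a finite set (`exists_finset_localRed_smul_frobenius`);
  the Teichmüller layers fix the reductions of finitely many points
  (`exists_layer_localRed_smul_eq`); a bounded multiple of every `ℚ_v`-rational point lies in
  `E₁` (`exists_nsmul_localRed_eq_zero_of_fixed`).

## References

* [GreenbergLNM1716] R. Greenberg, *Iwasawa theory for elliptic curves*, LNM 1716 (1999), §1
  p. 62, §2 p. 70, §3 Lemma 3.4 (p. 89).
* [SilvermanAEC2009] J. H. Silverman, *The Arithmetic of Elliptic Curves*, 2nd ed. (2009),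
  V.3.1, VII.2.1–2.2, VII.3.1.
* [SerreLocalFields1979] J.-P. Serre, *Local Fields* (1979), II §4 Prop. 8.
-/

noncomputable section

open scoped Classical NNReal AddSubgroup
open NumberField IsDedekindDomain Polynomial

universe u

/-! ## §1 Two local preliminaries at the place of `ℚ` above `p` -/

namespace IsDedekindDomain.HeightOneSpectrum

open Literature.NumberTheory.EllipticCurves Literature.NumberTheory.GaloisRepresentations Field

/-- **`p` is a uniformiser of `ℤ_v`** for the place `v ∋ p` of `ℚ`: the element `p ∈ 𝓞_v` is
irreducible (transport of `PadicInt.irreducible_p` along Mathlib's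
`ℤ_v ≃ ℤ_[p]`, `Rat.HeightOneSpectrum.adicCompletionIntegers.padicIntEquiv`). [folklore] -/
theorem irreducible_natCast_adicCompletionIntegers_rat {p : ℕ} [hp : Fact p.Prime]
    {v : HeightOneSpectrum (𝓞 ℚ)} (hpv : (p : 𝓞 ℚ) ∈ v.asIdeal) :
    Irreducible ((p : ℕ) : v.adicCompletionIntegers ℚ) := by
  haveI := Fact.mk (Rat.HeightOneSpectrum.primesEquiv v).2
  have hq : ((Rat.HeightOneSpectrum.primesEquiv v : Nat.Primes) : ℕ) = p :=
    Rat.HeightOneSpectrum.primesEquiv_eq_of_natCast_mem v hp.out hpv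
  have key : ∀ (q : ℕ) (hq' : Fact q.Prime), q = p → Irreducible ((p : ℕ) : ℤ_[q]) := by
    rintro q hq' rfl
    exact PadicInt.irreducible_p
  have h := key _ (Fact.mk (Rat.HeightOneSpectrum.primesEquiv v).2) hq
  rw [← map_natCast (Rat.HeightOneSpectrum.adicCompletionIntegers.padicIntEquiv v) p] at h
  exact (MulEquiv.irreducible_iff (Rat.HeightOneSpectrum.adicCompletionIntegers.padicIntEquiv v)).mp h

/-- **An element of `Γ_{K_v}` fixing every `p`-power root of unity of `K̄_v` restricts into
`Gal(K̄/K_∞) = ker κ` for the cyclotomic `ℤ_p`-extension `κ`** (`ker κ = χ_p⁻¹(μ(ℤ_p))`, and the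
restriction has `χ_p = 1` since it fixes `closureEmb(μ_{p^∞}(K̄)) ⊆ μ_{p^∞}(K̄_v)`). The argument
of `ZpExtension.IsCyclotomic.exists_isArithFrobAt_resGal_mem_kerSubgroup`
(`CyclotomicTowerLocalFrobeniusProofs`), isolated. Washington, *Cyclotomic Fields*, §13.1;
Greenberg, LNM 1716, §3 p. 89. [cite: GreenbergLNM1716, §3 Lemma 3.4 (p. 89)] -/
theorem resGal_mem_kerSubgroup_of_forall_smul_rootOfUnity_eq {K : Type u} [Field K] [NumberField K]
    {v : HeightOneSpectrum (𝓞 K)} {p : ℕ} [hp : Fact p.Prime] {κ : ZpExtension K p}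
    (hκ : κ.IsCyclotomic) {τ : absoluteGaloisGroup (v.adicCompletion K)}
    (hτfix : ∀ (k : ℕ) (ξ : AlgebraicClosure (v.adicCompletion K)), ξ ^ p ^ k = 1 → τ • ξ = ξ) :
    resGal (K := K) (v.adicCompletion K) τ ∈ κ.kerSubgroup := by
  have hpp := hp.out
  set σ : absoluteGaloisGroup K := resGal (K := K) (v.adicCompletion K) τ with hσdef
  -- `σ` fixes the `p`-power roots of unity of `K̄`
  have hfix : ∀ (k : ℕ) (t : AlgebraicClosure K), t ^ p ^ k = 1 → σ • t = t := by
    intro k t ht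
    apply (closureEmb (K := K) (v.adicCompletion K)).toRingHom.injective
    have h1 : closureEmb (K := K) (v.adicCompletion K) (σ • t) =
        τ • closureEmb (K := K) (v.adicCompletion K) t :=
      AlgHom.congr_fun (closureEmb_comp_resGalAux (K := K) (v.adicCompletion K) τ) t
    change closureEmb (K := K) (v.adicCompletion K) (σ • t) = closureEmb (K := K) (v.adicCompletion K) t
    rw [h1]
    exact hτfix k _ (by rw [← map_pow, ht, map_one])
  -- hence `χ_p(σ) = 1`
  have hχ : GaloisRep.cyclotomicCharacter K p σ = 1 := by
    haveI : NeZero (p : K) := ⟨Nat.cast_ne_zero.mpr hpp.ne_zero⟩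
    refine Units.ext (PadicInt.ext_of_toZModPow.mp fun k ↦ ?_)
    rw [Units.val_one, map_one]
    cases k with
    | zero =>
      haveI : Subsingleton (ZMod (p ^ 0)) := by rw [pow_zero]; infer_instance
      exact Subsingleton.elim _ _
    | succ k =>
      haveI : NeZero ((p ^ (k + 1) : ℕ) : AlgebraicClosure K) :=
        ⟨by exact_mod_cast pow_ne_zero (k + 1) hpp.ne_zero⟩
      obtain ⟨t, ht⟩ := HasEnoughRootsOfUnity.exists_primitiveRoot (AlgebraicClosure K) (p ^ (k + 1))
      have hspec := GaloisRep.cyclotomicCharacter_spec K p (k := k + 1) σ t ht.pow_eq_one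
      rw [hfix (k + 1) t ht.pow_eq_one] at hspec
      have hlt : 1 < p ^ (k + 1) := Nat.one_lt_pow (by omega) hpp.one_lt
      haveI : Fact (1 < p ^ (k + 1)) := ⟨hlt⟩
      have hc := ht.pow_inj (ZMod.val_lt _) hlt (hspec.symm.trans (pow_one t).symm)
      exact ZMod.val_injective _ (hc.trans (ZMod.val_one _).symm)
  rw [show κ.kerSubgroup = _ from hκ, Subgroup.mem_comap, CommGroup.mem_torsion]
  change IsOfFinOrder (GaloisRep.cyclotomicCharacter K p σ)
  rw [hχ]
  exact IsOfFinOrder.one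

end IsDedekindDomain.HeightOneSpectrum

/-! ## §2 The reduction map of a globally minimal `W/ℚ` at `v ∋ p` on `E(K̄_v)` -/

namespace WeierstrassCurve

open Literature.NumberTheory.EllipticCurves Literature.NumberTheory.GaloisRepresentations Field
  IsDedekindDomain.HeightOneSpectrum Literature.NumberTheory.EllipticCurves.FormalGroupChart
  Literature.NumberTheory.EllipticCurves.ResKernel

variable (W : WeierstrassCurve ℚ) [W.IsGloballyMinimal] {p : ℕ} [hp : Fact p.Prime]
  {v : HeightOneSpectrum (𝓞 ℚ)}
  {w : Valuation (AlgebraicClosure (v.adicCompletion ℚ)) ℝ≥0}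
  (hw : ∀ x, (w x : ℝ) = spectralNorm (v.adicCompletion ℚ) (AlgebraicClosure (v.adicCompletion ℚ)) x)
  (hΔu : IsUnit ((integralModelInt W).map (algebraMap ℤ ↥w.valuationSubring)).Δ)
  (red₀ : localPoints W (v.adicCompletion ℚ) →+
    (((integralModelInt W).map (algebraMap ℤ ↥w.valuationSubring)).map
      (IsLocalRing.residue ↥w.valuationSubring)).toAffine.Point)
  (hred₀ : ∀ P : localPoints W (v.adicCompletion ℚ), red₀ P =
    ((integralModelInt W).map (algebraMap ℤ ↥w.valuationSubring)).reducePoint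
      (Affine.Point.congrEquiv (localIntModel_baseChange W w.valuationSubring).symm P))

/-- Over the subring `𝒪_w = w.integer` the curve `W ⊗ K̄_v` of a globally minimal `W/ℚ` is the
base change of `W_ℤ ⊗ 𝒪_w` (so it has `w`-integral coefficients, the hypothesis of the
formal-group files). [folklore] -/
theorem baseChange_eq_localIntModel_integer_baseChange :
    W.baseChange (AlgebraicClosure (v.adicCompletion ℚ)) =
      ((integralModelInt W).map (algebraMap ℤ ↥w.integer)).baseChange
        (AlgebraicClosure (v.adicCompletion ℚ)) := by
  conv_lhs => rw [← map_integralModelInt W]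
  rw [baseChange, baseChange, WeierstrassCurve.map_map, WeierstrassCurve.map_map]
  congr 1
  exact RingHom.ext_int _ _

include hw hΔu hred₀ in
/-- **`E₁ = ker red₀` is `Γ_{K_v}`-stable**: `red₀ (σP) = 0 ↔ red₀ P = 0` (`σ` is a `w`-isometry;
`reducesToZero_congrEquiv_map_iff`). Silverman, *AEC*, VII.§2, VIII.§1. [folklore] -/
theorem localRed_smul_eq_zero_iff (σ : absoluteGaloisGroup (v.adicCompletion ℚ))
    (P : localPoints W (v.adicCompletion ℚ)) : red₀ (σ • P) = 0 ↔ red₀ P = 0 := by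
  have hvO : w.Integers w.valuationSubring := Valuation.valuationSubring.integers w
  rw [hred₀, hred₀]
  change goodReductionHom _ hvO hΔu _ = 0 ↔ goodReductionHom _ hvO hΔu _ = 0
  rw [goodReductionHom_eq_zero_iff, goodReductionHom_eq_zero_iff, localPoints.smul_def]
  exact reducesToZero_congrEquiv_map_iff _ (localIntModel_baseChange W w.valuationSubring).symm _
    (fun z ↦ spectralValuation_smul hw σ z) _

include hΔu hred₀ in
/-- **`ker red₀` is the formal-group kernel `E₁` of the coordinates chart** (`FormalGroupChart.kernel`):
both are `{O} ∪ {(x, y) : w x > 1}` (`reducesToZero_some_iff`, `some_mem_kernel_iff`).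
Silverman, *AEC*, VII.2.1–2.2. [folklore] -/
theorem localRed_eq_zero_iff_mem_kernel
    [hV : (W.baseChange (AlgebraicClosure (v.adicCompletion ℚ))).IsIntegral w.integer]
    (P : localPoints W (v.adicCompletion ℚ)) :
    red₀ P = 0 ↔ (P : (W.baseChange (AlgebraicClosure (v.adicCompletion ℚ))).toAffine.Point) ∈
      kernel w (W.baseChange (AlgebraicClosure (v.adicCompletion ℚ))) := by
  have hvO : w.Integers w.valuationSubring := Valuation.valuationSubring.integers w
  rw [hred₀]
  change goodReductionHom _ hvO hΔu _ = 0 ↔ _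
  rw [goodReductionHom_eq_zero_iff]
  change (W.baseChange (AlgebraicClosure (v.adicCompletion ℚ))).toAffine.Point at P
  rcases P with _ | ⟨x, y, h⟩
  · rw [← Affine.Point.zero_def, map_zero]
    exact ⟨fun _ ↦ (kernel w _).zero_mem, fun _ ↦ reducesToZero_zero⟩
  · rw [Affine.Point.congrEquiv_some, reducesToZero_some_iff, not_mem_range_iff hvO]
    exact (some_mem_kernel_iff (w := w) h).symm

variable [W.IsElliptic]

include hw hΔu hred₀ in
/-- **The ordinary point**: for `p ∤ Δ_W`, `p ∤ a_p` some `p`-torsion point of `E(K̄_v)` has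
non-zero reduction (`exists_zsmul_eq_zero_spectralValuation_le_one`: a `p`-torsion point with
integral abscissa reduces to an affine point). Serre (1972), §1.11; Silverman, *AEC*, V.3.1,
VII.2.1. [cite: SilvermanAEC2009, Thm. V.3.1(a) and Prop. VII.2.1] -/
theorem exists_zsmul_eq_zero_localRed_ne_zero (hpv : (p : 𝓞 ℚ) ∈ v.asIdeal)
    (hΔ : ¬ (p : ℤ) ∣ minimalDiscriminantInt W) (hord : ¬ (p : ℤ) ∣ W.frobeniusTrace p) :
    ∃ P : localPoints W (v.adicCompletion ℚ), (p : ℤ) • P = 0 ∧ red₀ P ≠ 0 := by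
  obtain ⟨x, y, h, hpP, hx⟩ := W.exists_zsmul_eq_zero_spectralValuation_le_one hpv hw hΔ hord
  refine ⟨Affine.Point.some x y h, hpP, ?_⟩
  obtain ⟨hy, hns, e⟩ := reducePoint_congrEquiv_some_of_val_le_one hΔu
    (localIntModel_baseChange W w.valuationSubring) x y h hx
  rw [hred₀, e]
  exact Affine.Point.some_ne_zero hns

omit [W.IsElliptic] in
include hΔu hred₀ in
/-- **The ordinary filtration on `E(K̄_v)`** (transport of `OrdinaryReductionKernelTorsionProofs` §5
along `W_ℤ ⊗ K̄_v = W ⊗ K̄_v`): if some `p`-torsion point has non-zero reduction, then for every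
`r` the group `ker red₀ ∩ E[p^r]` is cyclic of order `p^r` on a generator, `red₀` maps `E[p^r]`
onto `Ẽ[p^r]`, and `ker red₀` is `p`-divisible. Greenberg, LNM 1716, §1 p. 62
(`0 → ℱ[p^∞] → E[p^∞] → Ẽ[p^∞] → 0`, `ℱ[p^∞] ≅ ℚ_p/ℤ_p`). [cite: GreenbergLNM1716, §1 p. 62] -/
theorem localRed_ordinary_filtration [CharP (IsLocalRing.ResidueField ↥w.valuationSubring) p]
    (hordA : ∃ P : localPoints W (v.adicCompletion ℚ), (p : ℤ) • P = 0 ∧ red₀ P ≠ 0) :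
    (∀ r : ℕ, ∃ P₁ : localPoints W (v.adicCompletion ℚ), red₀ P₁ = 0 ∧ addOrderOf P₁ = p ^ r ∧
      ∀ P : localPoints W (v.adicCompletion ℚ), red₀ P = 0 → ((p ^ r : ℕ) : ℤ) • P = 0 →
        ∃ c : ℕ, P = c • P₁) ∧
    (∀ (r : ℕ) (y : (((integralModelInt W).map (algebraMap ℤ ↥w.valuationSubring)).map
        (IsLocalRing.residue ↥w.valuationSubring)).toAffine.Point), ((p ^ r : ℕ) : ℤ) • y = 0 →
      ∃ x : localPoints W (v.adicCompletion ℚ), ((p ^ r : ℕ) : ℤ) • x = 0 ∧ red₀ x = y) ∧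
    (∀ a : localPoints W (v.adicCompletion ℚ), red₀ a = 0 →
      ∃ b : localPoints W (v.adicCompletion ℚ), red₀ b = 0 ∧ p • b = a) := by
  haveI : CharZero (AlgebraicClosure (v.adicCompletion ℚ)) :=
    charZero_of_injective_algebraMap (algebraMap ℚ (AlgebraicClosure (v.adicCompletion ℚ))).injective
  have hvO : w.Integers w.valuationSubring := Valuation.valuationSubring.integers w
  let T : localPoints W (v.adicCompletion ℚ) ≃+
      (((integralModelInt W).map (algebraMap ℤ ↥w.valuationSubring)).baseChange
        (AlgebraicClosure (v.adicCompletion ℚ))).toAffine.Point :=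
    Affine.Point.congrEquiv (localIntModel_baseChange W w.valuationSubring).symm
  have hT : ∀ P : localPoints W (v.adicCompletion ℚ),
      red₀ P = goodReductionHom _ hvO hΔu (T P) := fun P ↦ hred₀ P
  have hordM : ∃ P : (((integralModelInt W).map (algebraMap ℤ ↥w.valuationSubring)).baseChange
      (AlgebraicClosure (v.adicCompletion ℚ))).toAffine.Point,
      (p : ℤ) • P = 0 ∧ goodReductionHom _ hvO hΔu P ≠ 0 := by
    obtain ⟨P, hpP, hP⟩ := hordA
    exact ⟨T P, by rw [← map_zsmul T, hpP, map_zero], by rwa [← hT]⟩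
  refine ⟨fun r ↦ ?_, fun r y hy ↦ ?_, fun a ha ↦ ?_⟩
  · obtain ⟨P₁, hP₁, hord₁, hgen₁⟩ :=
      exists_generator_torsionBy_ker_goodReductionHom w.valuationSubring hvO hΔu hordM r
    refine ⟨T.symm P₁, by rw [hT, AddEquiv.apply_symm_apply]; exact hP₁, ?_, fun P hP hpP ↦ ?_⟩
    · rw [← hord₁]
      exact addOrderOf_injective T.symm.toAddMonoidHom T.symm.injective P₁
    · obtain ⟨c, hc⟩ := hgen₁ (T P) (by rw [← hT]; exact hP) (by rw [← map_zsmul T, hpP, map_zero])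
      exact ⟨c, T.injective (by rw [hc, map_nsmul, AddEquiv.apply_symm_apply])⟩
  · obtain ⟨P, hpP, hP⟩ :=
      (natCard_torsionBy_ker_goodReductionHom_eq w.valuationSubring hvO hΔu hordM r).2 y hy
    exact ⟨T.symm P, by rw [← map_zsmul T.symm, hpP, map_zero],
      by rw [hT, AddEquiv.apply_symm_apply]; exact hP⟩
  · obtain ⟨R, hR, hpR⟩ := exists_nsmul_eq_of_goodReductionHom_eq_zero w.valuationSubring hvO hΔu
      hordM (T a) (by rw [← hT]; exact ha)
    exact ⟨T.symm R, by rw [hT, AddEquiv.apply_symm_apply]; exact hR,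
      T.injective (by rw [map_nsmul, AddEquiv.apply_symm_apply, hpR])⟩

omit [W.IsElliptic] in
include hw in
/-- **`E(K̄_v)/E₁` is torsion**: every point has a positive multiple in `ker red₀`, because its
reduction is a point of `W_ℤ mod 𝔪_w` over the residue field of `K̄_v`, which is algebraic over
the finite field `k_v` (`isAlgebraic_residueField_integer`), hence of finite order
(`isOfFinAddOrder_point_of_isAlgebraic`). Greenberg, LNM 1716, §2 p. 70; Silverman, *AEC*,
VII.2.1. [folklore] -/
theorem exists_nsmul_localRed_eq_zero (P : localPoints W (v.adicCompletion ℚ)) :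
    ∃ n : ℕ, 0 < n ∧ red₀ (n • P) = 0 := by
  obtain ⟨ι, hι⟩ := exists_ringHom_adicCompletionIntegers_integer (v := v) hw
  haveI := isLocalHom_of_coe_eq hw hι
  letI : Algebra (IsLocalRing.ResidueField (v.adicCompletionIntegers ℚ))
      (IsLocalRing.ResidueField ↥w.valuationSubring) := (IsLocalRing.ResidueField.map ι).toAlgebra
  haveI : Algebra.IsAlgebraic (IsLocalRing.ResidueField (v.adicCompletionIntegers ℚ))
      (IsLocalRing.ResidueField ↥w.valuationSubring) := isAlgebraic_residueField_integer hw hι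
  haveI : Finite (IsLocalRing.ResidueField (v.adicCompletionIntegers ℚ)) :=
    finite_residueField_adicCompletionIntegers ℚ v
  have hred : ((integralModelInt W).map (algebraMap ℤ ↥w.valuationSubring)).map
      (IsLocalRing.residue ↥w.valuationSubring) =
      ((integralModelInt W).map
        (algebraMap ℤ (IsLocalRing.ResidueField (v.adicCompletionIntegers ℚ)))).baseChange
        (IsLocalRing.ResidueField ↥w.valuationSubring) := by
    simp only [baseChange, WeierstrassCurve.map_map]
    congr 1
    exact RingHom.ext_int _ _
  have h1 : IsOfFinAddOrder (Affine.Point.congrEquiv hred (red₀ P)) :=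
    isOfFinAddOrder_point_of_isAlgebraic _ _
  have h2 := (Affine.Point.congrEquiv hred).symm.toAddMonoidHom.isOfFinAddOrder h1
  rw [AddEquiv.coe_toAddMonoidHom, AddEquiv.symm_apply_apply] at h2
  refine ⟨addOrderOf (red₀ P), h2.addOrderOf_pos, ?_⟩
  rw [map_nsmul]
  exact addOrderOf_nsmul_eq_zero (red₀ P)

omit [W.IsElliptic] in
include hw hΔu hred₀ in
/-- **The reductions fixed by a Frobenius form a finite set `SF`** ("`Ẽ(𝔽_p)` is finite"): for an
arithmetic Frobenius `τ` at `𝔐`, all `red₀ Q` with `red₀ (τQ) = red₀ Q` lie in a fixed finite set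
(`finite_setOf_reducePoint_smul_frobenius_eq`). Greenberg, LNM 1716, §2 p. 70.
[cite: GreenbergLNM1716, §2 p. 70] -/
theorem exists_finset_localRed_smul_frobenius {𝔐 : Ideal v.localAbsIntegers}
    (h𝔐 : 𝔐 ∈ v.localPrimesAbove) {τ : absoluteGaloisGroup (v.adicCompletion ℚ)}
    (hτ : IsArithFrobAt (v.adicCompletionIntegers ℚ) τ 𝔐) :
    ∃ SF : Finset ((((integralModelInt W).map (algebraMap ℤ ↥w.valuationSubring)).map
      (IsLocalRing.residue ↥w.valuationSubring)).toAffine.Point),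
      ∀ Q : localPoints W (v.adicCompletion ℚ), red₀ (τ • Q) = red₀ Q → red₀ Q ∈ SF := by
  have hfin := finite_setOf_reducePoint_smul_frobenius_eq hw h𝔐 hτ hΔu
    (localIntModel_baseChange W w.valuationSubring)
  refine ⟨hfin.toFinset, fun Q hQ ↦ hfin.mem_toFinset.mpr ⟨Q, (hred₀ Q).symm, ?_⟩⟩
  rw [← hred₀, hQ]

omit [W.IsElliptic] in
include hw hred₀ in
/-- **The Teichmüller layers fix the reductions of finitely many points**: for a finite set `F` of
points of `E(K̄_v)` there is `f ≥ 1` such that every `σ` fixing a primitive `(q^f - 1)`-th root of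
unity satisfies `red₀ (σQ) = red₀ Q` for all `Q ∈ F` (`exists_layer_forall_val_smul_sub_lt_one`
applied to the integral coordinates of the points of `F`, and
`reducePoint_congrEquiv_smul_eq_of_val`). Serre, *Local Fields*, II §4 Prop. 8; Greenberg,
LNM 1716, §2 p. 70. [cite: SerreLocalFields1979, Ch. II §4 Prop. 8] -/
theorem exists_layer_localRed_smul_eq {𝔐 : Ideal v.localAbsIntegers} (h𝔐 : 𝔐 ∈ v.localPrimesAbove)
    (F : Finset (localPoints W (v.adicCompletion ℚ))) :
    ∃ f : ℕ, f ≠ 0 ∧ ∀ ζL : AlgebraicClosure (v.adicCompletion ℚ),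
      IsPrimitiveRoot ζL (Nat.card (IsLocalRing.ResidueField (v.adicCompletionIntegers ℚ)) ^ f - 1) →
        ∀ σ : absoluteGaloisGroup (v.adicCompletion ℚ), σ • ζL = ζL →
          ∀ Q ∈ F, red₀ (σ • Q) = red₀ Q := by
  -- the integral coordinates of the points of `F`
  let coords : localPoints W (v.adicCompletion ℚ) → Finset (AlgebraicClosure (v.adicCompletion ℚ)) :=
    fun Q ↦ match (Q : (W.baseChange (AlgebraicClosure (v.adicCompletion ℚ))).toAffine.Point) with
      | .zero => ∅
      | .some x y _ => ({x, y} : Finset (AlgebraicClosure (v.adicCompletion ℚ)))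
  let X : Finset (AlgebraicClosure (v.adicCompletion ℚ)) :=
    (F.biUnion coords).filter fun z ↦ w z ≤ 1
  have hX : ∀ z ∈ X, w z ≤ 1 := fun z hz ↦ (Finset.mem_filter.mp hz).2
  have hmem : ∀ Q ∈ F, ∀ x y h, Q = Affine.Point.some x y h →
      (w x ≤ 1 → x ∈ X) ∧ (w y ≤ 1 → y ∈ X) := by
    intro Q hQ x y h hQxy
    have hx : x ∈ coords Q := by rw [hQxy]; exact Finset.mem_insert_self x {y}
    have hy : y ∈ coords Q := by
      rw [hQxy]; exact Finset.mem_insert_of_mem (Finset.mem_singleton_self y)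
    exact ⟨fun hx1 ↦ Finset.mem_filter.mpr ⟨Finset.mem_biUnion.mpr ⟨Q, hQ, hx⟩, hx1⟩,
      fun hy1 ↦ Finset.mem_filter.mpr ⟨Finset.mem_biUnion.mpr ⟨Q, hQ, hy⟩, hy1⟩⟩
  obtain ⟨n, hn, hlayer⟩ := exists_layer_forall_val_smul_sub_lt_one hw h𝔐 X hX
  refine ⟨n, hn, fun ζL hζL σ hσ Q hQ ↦ ?_⟩
  rw [hred₀, hred₀]
  refine reducePoint_congrEquiv_smul_eq_of_val hw (localIntModel_baseChange W w.valuationSubring)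
    σ Q fun x y h hQxy ↦ ⟨fun hx ↦ ?_, fun hy ↦ ?_⟩
  · exact hlayer ζL hζL σ hσ x ((hmem Q hQ x y h hQxy).1 hx)
  · exact hlayer ζL hζL σ hσ y ((hmem Q hQ x y h hQxy).2 hy)

omit [W.IsElliptic] in
include hw hΔu hred₀ in
/-- **A bounded multiple of every `K_v`-rational point lies in `E₁`**: with `SF` the finite set of
reductions fixed by a Frobenius `τ`, the image under `red₀` of the `Γ_{K_v}`-invariant points is a
finite subgroup of order `N₀`, and `N₀ a ∈ ker red₀` for every invariant `a` ("`E(K_v)/E₁(K_v) ↪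
Ẽ(k_v)`", Silverman, *AEC*, VII.2.1; the hypothesis of `exists_kummerPoint`).
[cite: SilvermanAEC2009, Prop. VII.2.1] -/
theorem exists_nsmul_localRed_eq_zero_of_fixed {𝔐 : Ideal v.localAbsIntegers}
    (h𝔐 : 𝔐 ∈ v.localPrimesAbove) {τ : absoluteGaloisGroup (v.adicCompletion ℚ)}
    (hτ : IsArithFrobAt (v.adicCompletionIntegers ℚ) τ 𝔐) :
    ∃ N₀ : ℕ, 0 < N₀ ∧ ∀ a : localPoints W (v.adicCompletion ℚ),
      (∀ σ : absoluteGaloisGroup (v.adicCompletion ℚ), σ • a = a) → red₀ (N₀ • a) = 0 := by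
  obtain ⟨SF, hSF⟩ := W.exists_finset_localRed_smul_frobenius hw hΔu red₀ hred₀ h𝔐 hτ
  -- the subgroup of invariant points and its (finite) image
  let AΓ : AddSubgroup (localPoints W (v.adicCompletion ℚ)) :=
    { carrier := {a | ∀ σ : absoluteGaloisGroup (v.adicCompletion ℚ), σ • a = a}
      zero_mem' := fun σ ↦ smul_zero σ
      add_mem' := fun {a b} ha hb σ ↦ by rw [smul_add, ha σ, hb σ]
      neg_mem' := fun {a} ha σ ↦ by rw [smul_neg, ha σ] }
  let S : AddSubgroup _ := AΓ.map red₀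
  haveI : Finite S := by
    refine Finite.of_injective (fun y : S ↦ (⟨(y : _), ?_⟩ : {b // b ∈ SF})) ?_
    · obtain ⟨a, ha, hay⟩ := AddSubgroup.mem_map.mp y.2
      rw [← hay]
      exact hSF a (by rw [ha τ])
    · intro a b h
      have h' := congrArg Subtype.val h
      dsimp only at h'
      exact Subtype.ext h'
  haveI : Nonempty S := ⟨0⟩
  refine ⟨Nat.card S, Nat.card_pos, fun a ha ↦ ?_⟩
  have hmem : red₀ a ∈ S := AddSubgroup.mem_map.mpr ⟨a, ha, rfl⟩
  have h0 : Nat.card S • (⟨red₀ a, hmem⟩ : S) = 0 := card_nsmul_eq_zero'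
  rw [map_nsmul]
  exact congrArg Subtype.val h0

end WeierstrassCurve
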